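import Literature.NumberTheory.Rogawski1990.FinExplicitTransferFactorDeepTauUniform
import HarnessLib

/-!
# The `Δ‴_v`-weighted class sum near `1 ∈ H_v` at an unramified inert place: `Σ_c Δ‴_v(γ_H, c)·O(c) = (−1)^n q_v^{−n} · Σ_c κ_v(γ_H, c)·O(c)`
# ([Rogawski1990] §4.9 p. 55, §4.3 p. 43, Prop. 8.1.3 p. 116; [LabesseLanglands1979] §2)

Topic `NumberTheory/Rogawski1990`; namespace `Literature.NumberTheory.Rogawski1990`.  THEOREMS ONLY (no definition, no instance, no notation, no named fact, no `sorry`).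
Cell `pub/hodgecm-mathlib` (D-0151), crux H413 = `stmt-HodgeConjecture-24833`, line «N6nsGerm», last open stub `stub_N6nsS3id`; road «S3-tree» (architect A-p16, census v3
0ca147ac; END CONTRACT v1 (F0P3a-p03 (g14)) stub «GEN» ∕ ruling A-58 (iii)), brick **T5-Σ** (T5 holder F0P3a-p04 (g15)): the right-hand side of the S3 identity at `1`,
`Σ_{c ∈ Cl(G′_v)} Δ_v(γ_H, c)·O_c(g)` with `Δ_v` = ★ `finExplicitCollection` (typ-T6b), has its TRANSFER-FACTOR SCALAR PULLED OUT near `1`: by ★ T5-u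
(`exists_nhds_one_forall_finExplicitDelta_eq_neg_pow_mul_kappa`: `Δ‴_v = (−1)^n q_v^{−n}·κ_v` on matched pairs, `n = ord_w χ_g(u)`) and the support axiom
(`Δ‴_v = 0` off matched pairs ★ `finExplicitDelta_of_not_isLocalNormPair`),
`Σ_c Δ_v(γ_H, c)·O(c) = (−1)^n q_v^{−n} · Σ_c [ι_v(γ_H) ↔ c]·κ_v(γ_H, c)·O(c)` for EVERY weight `O : Cl(G′_v) → ℂ` (in the END: `O = classOrbitalIntegral mG g`) — so «GEN»'s
right-hand side is `(−1)^n q_v^{−n}` times the `κ`-ORBITAL SUM, the object T3′∕T4′ count.  The depth `n` is offered in both currencies: as a binder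
(`|χ_g(u)_w| = |ϖ^n|`) and as the FUNCTION `n(γ_H) := (−log |χ_g(u)_w|).toNat` of `γ_H` (valid near `1`, where `|χ_g(u)_w| < 1`, §1).  ROAD-INDEPENDENT; HONEST LABEL:
HC_CM is proved only modulo the printed citations (2 remaining named inputs hLiu418, h413) until rung 0 closes; nothing printed is asserted here.

* §1 `eventually_nhds_one_valued_eval_lt_one` (`|χ_g(u)_w| < 1` near `1`), `valued_eval_eq_pow_toNat_of_ne_zero` (the depth as a function, unramified `w`).
* §2 **`exists_nhds_one_forall_finsum_Δ_mul_eq`** (binder currency) and **`exists_nhds_one_forall_finsum_Δ_mul_eq_toNat`** (function currency); the pointwise value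
  `exists_nhds_one_forall_finExplicitDelta_eq_toNat`.

## References
* [Rogawski1990] J. D. Rogawski, *Automorphic Representations of Unitary Groups in Three Variables* (1990): §4.9 p. 55 (`Δ_{G∕H} = τ·D·κ`), §4.3 p. 43 (support on
  matched pairs), Prop. 8.1.3 p. 116.
* [LabesseLanglands1979] J.-P. Labesse, R. P. Langlands, *L-indistinguishability for SL(2)*, Canad. J. Math. 31 (1979): §2.
-/

set_option autoImplicit false

noncomputable section

open NumberField IsDedekindDomain Filter Topology Matrix

namespace Literature.NumberTheory.Rogawski1990

open Literature.NumberTheory.Automorphic Literature.NumberTheory.Automorphic.UnitaryGroup Literature.NumberTheory.GaloisRepresentations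

variable (L : Type) [Field L] [NumberField L] [IsCMField L] (v : HeightOneSpectrum (𝓞 ↥(maximalRealSubfield L)))
  (w : PlacesOver L v) (hw : IsCMField.complexConj L • w.1 = w.1)

/-! ## §1 The depth `n(γ_H) = ord_w χ_g(u)` as a function near `1` -/

section DepthFunction

/-- **`|χ_g(u)_w|_w < 1` EVENTUALLY NEAR `1 ∈ H_v`** (`γ_H ↦ χ_g(u)` is continuous ★ and `χ_1(1) = (1 − 1)² = 0`). [cite: Rogawski1990, §4.9 p. 55] -/
theorem eventually_nhds_one_valued_eval_lt_one :
    ∀ᶠ γH : (cmDatum L 2 (Matrix.of fun i j : Fin 2 => if i.val + j.val + 1 = 2 then (1 : L) else 0)).Local v ×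
        (cmDatum L 1 (Matrix.of fun i j : Fin 1 => if i.val + j.val + 1 = 1 then (1 : L) else 0)).Local v in 𝓝 1,
      Valued.v (((finCharpolyTwo L v γH).eval (finGammaTwo L v γH)) w) < 1 := by
  have hc : Continuous fun γH : (cmDatum L 2 (Matrix.of fun i j : Fin 2 => if i.val + j.val + 1 = 2 then (1 : L) else 0)).Local v ×
        (cmDatum L 1 (Matrix.of fun i j : Fin 1 => if i.val + j.val + 1 = 1 then (1 : L) else 0)).Local v =>
      ((finCharpolyTwo L v γH).eval (finGammaTwo L v γH)) w :=
    (continuous_apply w).comp (continuous_eval_finCharpolyTwo L v)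
  have h1 : ((finCharpolyTwo L v (1 : (cmDatum L 2 (Matrix.of fun i j : Fin 2 => if i.val + j.val + 1 = 2 then (1 : L) else 0)).Local v ×
        (cmDatum L 1 (Matrix.of fun i j : Fin 1 => if i.val + j.val + 1 = 1 then (1 : L) else 0)).Local v)).eval (finGammaTwo L v 1)) w = 0 := by
    have hu : finGammaTwo L v (1 : (cmDatum L 2 (Matrix.of fun i j : Fin 2 => if i.val + j.val + 1 = 2 then (1 : L) else 0)).Local v ×
        (cmDatum L 1 (Matrix.of fun i j : Fin 1 => if i.val + j.val + 1 = 1 then (1 : L) else 0)).Local v) = 1 := by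
      funext w'
      change (1 : Matrix (Fin 1) (Fin 1) (LocalRing L v)) 0 0 w' = 1
      rw [Matrix.one_apply_eq, Pi.one_apply]
    have hg : (((1 : (cmDatum L 2 (Matrix.of fun i j : Fin 2 => if i.val + j.val + 1 = 2 then (1 : L) else 0)).Local v ×
        (cmDatum L 1 (Matrix.of fun i j : Fin 1 => if i.val + j.val + 1 = 1 then (1 : L) else 0)).Local v)).1.val.val :
          Matrix (Fin 2) (Fin 2) (LocalRing L v)) = 1 := rfl
    rw [eval_finCharpolyTwo_finGammaTwo, hu, hg, Matrix.det_one, Matrix.trace_one, Fintype.card_fin]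
    simp only [Pi.add_apply, Pi.sub_apply, Pi.mul_apply, Pi.one_apply, Pi.natCast_apply]
    norm_num
  have hball : {x : w.1.adicCompletion L | Valued.v x < 1} ∈ 𝓝 (0 : w.1.adicCompletion L) := by
    refine Filter.mem_of_superset (Metric.ball_mem_nhds (0 : w.1.adicCompletion L) one_pos) fun x hx => ?_
    rw [Metric.mem_ball, dist_zero_right] at hx
    exact Valued.toNormedField.norm_lt_one_iff.1 hx
  exact hc.continuousAt.preimage_mem_nhds (by rw [h1]; exact hball)

variable (hunr : Algebra.IsUnramifiedIn (𝓞 L) v.asIdeal)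

omit [IsCMField L] in
include hunr in
/-- **THE DEPTH AS A FUNCTION** (unramified `w`, `|ϖ|_w = exp(−1)`): for `x ≠ 0` with `|x|_w ≤ 1`, `|x|_w = |ϖ^{n}|_w` with `n := (−log |x|_w).toNat`.
[cite: Rogawski1990, §4.9 p. 55] -/
theorem valued_eq_pow_toNat_of_ne_zero {x : w.1.adicCompletion L} (hx0 : x ≠ 0) (hx1 : Valued.v x ≤ 1) :
    Valued.v x = Valued.v ((toPlace v w (HeckeCharacter.uniformizer ↥(maximalRealSubfield L) v : v.adicCompletion ↥(maximalRealSubfield L))) ^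
      (-WithZero.log (Valued.v x)).toNat) := by
  have h0 : Valued.v x ≠ 0 := (Valuation.ne_zero_iff _).2 hx0
  have hlog : WithZero.log (Valued.v x) ≤ 0 := (WithZero.log_le_iff_le_exp h0).2 (by rwa [WithZero.exp_zero])
  have hN : ((-WithZero.log (Valued.v x)).toNat : ℤ) = -WithZero.log (Valued.v x) := Int.toNat_of_nonneg (neg_nonneg.2 hlog)
  rw [Valuation.map_pow, Liu2021.LemD1IndexedNonVacuityInertCofinite.valued_toPlace_uniformizer_of_isUnramifiedIn L v hunr w, ← WithZero.exp_nsmul, smul_neg,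
    nsmul_eq_mul, mul_one, hN, neg_neg, WithZero.exp_log h0]

end DepthFunction

/-! ## §2 The scalar pulled out of the `Δ_v`-weighted class sum near `1` -/

section ScalarPull

variable (hunr : Algebra.IsUnramifiedIn (𝓞 L) v.asIdeal) (μ : HeckeCharacter L)
  (hμω : ∀ x : ideleGroup ↥(maximalRealSubfield L), μ (AdeleRing.ideleBaseChange ↥(maximalRealSubfield L) L x) = quadraticHeckeCharCM L x)
  (H' : Matrix (Fin 3) (Fin 3) L)
  (hl : ∀ (v : HeightOneSpectrum (𝓞 ↥(maximalRealSubfield L)))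
    (a : (cmDatum L 2 (Matrix.of fun i j : Fin 2 => if i.val + j.val + 1 = 2 then (1 : L) else 0)).Local v ×
      (cmDatum L 1 (Matrix.of fun i j : Fin 1 => if i.val + j.val + 1 = 1 then (1 : L) else 0)).Local v)
    (b : (cmDatum L 3 H').Local v)
    (x : (cmDatum L 2 (Matrix.of fun i j : Fin 2 => if i.val + j.val + 1 = 2 then (1 : L) else 0)).Local v ×
      (cmDatum L 1 (Matrix.of fun i j : Fin 1 => if i.val + j.val + 1 = 1 then (1 : L) else 0)).Local v),
    finExplicitDelta L v H' (x * a * x⁻¹) μ b = finExplicitDelta L v H' a μ b)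
  (hr : ∀ (v : HeightOneSpectrum (𝓞 ↥(maximalRealSubfield L)))
    (a : (cmDatum L 2 (Matrix.of fun i j : Fin 2 => if i.val + j.val + 1 = 2 then (1 : L) else 0)).Local v ×
      (cmDatum L 1 (Matrix.of fun i j : Fin 1 => if i.val + j.val + 1 = 1 then (1 : L) else 0)).Local v)
    (b y : (cmDatum L 3 H').Local v),
    finExplicitDelta L v H' a μ (y * b * y⁻¹) = finExplicitDelta L v H' a μ b)

open scoped Classical in
include hw hunr hμω in
/-- **THE SCALAR PULLED OUT (binder currency).**  Non-split `v` unramified in `L`, guard `μ|_{𝕀_{L⁺}} = ω`: there is `V ∈ 𝓝 (1 : H_v)` such that for every `γ_H ∈ V`,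
every `n` with `|χ_g(u)_w|_w = |ϖ^n|_w` and EVERY weight `O : Cl(G′_v) → ℂ`,
`Σᶠ_c Δ_v(γ_H, c̃)·O(c) = (−1)^n q_v^{−n} · Σᶠ_c [ι_v(γ_H) ↔ c̃]·κ_v(γ_H, c̃)·O(c)` (`c̃ = Quotient.out c`, `Δ_v` = ★ `finExplicitCollection … v`).
[cite: Rogawski1990, §4.9 p. 55; §4.3 p. 43; Prop. 8.1.3 p. 116] [cite: LabesseLanglands1979, §2] -/
theorem exists_nhds_one_forall_finsum_Δ_mul_eq :
    ∃ V ∈ 𝓝 (1 : (cmDatum L 2 (Matrix.of fun i j : Fin 2 => if i.val + j.val + 1 = 2 then (1 : L) else 0)).Local v ×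
        (cmDatum L 1 (Matrix.of fun i j : Fin 1 => if i.val + j.val + 1 = 1 then (1 : L) else 0)).Local v),
      ∀ γH ∈ V, ∀ (n : ℕ) (O : ConjClasses ((cmDatum L 3 H').Local v) → ℂ),
        Valued.v (((finCharpolyTwo L v γH).eval (finGammaTwo L v γH)) w) =
          Valued.v ((toPlace v w (HeckeCharacter.uniformizer ↥(maximalRealSubfield L) v : v.adicCompletion ↥(maximalRealSubfield L))) ^ n) →
        ∑ᶠ c : ConjClasses ((cmDatum L 3 H').Local v), (finExplicitCollection L H' μ hl hr v).Δ γH (Quotient.out c) * O c =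
          (-1 : ℂ) ^ n * (((Nat.card (𝓞 ↥(maximalRealSubfield L) ⧸ v.asIdeal) : ℂ) ^ n))⁻¹ *
            ∑ᶠ c : ConjClasses ((cmDatum L 3 H').Local v),
              (if IsLocalNormPair L H' v γH (Quotient.out c) then ((finKappaAt L v H' γH (Quotient.out c) : ℤ) : ℂ) else 0) * O c := by
  obtain ⟨V, hV, h⟩ := exists_nhds_one_forall_finExplicitDelta_eq_neg_pow_mul_kappa L v w hw hunr μ hμω H'
  refine ⟨V, hV, fun γH hγ n O hχ => ?_⟩
  rw [mul_finsum]
  refine finsum_congr fun c => ?_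
  rw [finExplicitCollection_Δ]
  by_cases hp : IsLocalNormPair L H' v γH (Quotient.out c)
  · rw [h γH hγ n (Quotient.out c) hχ hp, if_pos hp]
    ring
  · rw [finExplicitDelta_of_not_isLocalNormPair L v H' γH μ hp, if_neg hp, zero_mul, mul_zero]

open scoped Classical in
include hw hunr hμω in
/-- **`Δ‴_v(γ_H, γ′) = (−1)^{n(γ_H)} q_v^{−n(γ_H)}·κ_v(γ_H, γ′)` NEAR `1`, DEPTH AS A FUNCTION** (`n(γ_H) := (−log |χ_g(u)_w|).toNat`; `γ_H` `G`-regular at `w`, i.e.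
`χ_g(u)_w ≠ 0`; matched pairs). [cite: Rogawski1990, §4.9 p. 55; Prop. 8.1.3 p. 116] -/
theorem exists_nhds_one_forall_finExplicitDelta_eq_toNat :
    ∃ V ∈ 𝓝 (1 : (cmDatum L 2 (Matrix.of fun i j : Fin 2 => if i.val + j.val + 1 = 2 then (1 : L) else 0)).Local v ×
        (cmDatum L 1 (Matrix.of fun i j : Fin 1 => if i.val + j.val + 1 = 1 then (1 : L) else 0)).Local v),
      ∀ γH ∈ V, ∀ γ' : (cmDatum L 3 H').Local v, ((finCharpolyTwo L v γH).eval (finGammaTwo L v γH)) w ≠ 0 → IsLocalNormPair L H' v γH γ' →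
        finExplicitDelta L v H' γH μ γ' =
          (-1 : ℂ) ^ (-WithZero.log (Valued.v (((finCharpolyTwo L v γH).eval (finGammaTwo L v γH)) w))).toNat *
            (((Nat.card (𝓞 ↥(maximalRealSubfield L) ⧸ v.asIdeal) : ℂ) ^
              (-WithZero.log (Valued.v (((finCharpolyTwo L v γH).eval (finGammaTwo L v γH)) w))).toNat))⁻¹ *
            ((finKappaAt L v H' γH γ' : ℤ) : ℂ) := by
  obtain ⟨V, hV, h⟩ := exists_nhds_one_forall_finExplicitDelta_eq_neg_pow_mul_kappa L v w hw hunr μ hμω H'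
  obtain ⟨U, hU, hU1⟩ := (eventually_nhds_one_valued_eval_lt_one L v w).exists_mem
  refine ⟨V ∩ U, Filter.inter_mem hV hU, fun γH hγ γ' hχ0 hpair => ?_⟩
  exact h γH hγ.1 _ γ' (valued_eq_pow_toNat_of_ne_zero L v w hunr hχ0 (hU1 γH hγ.2).le) hpair

open scoped Classical in
include hw hunr hμω in
/-- **THE SCALAR PULLED OUT (function currency):** `V ∈ 𝓝 (1 : H_v)` with, for every `γ_H ∈ V` that is `G`-regular at `w` (`χ_g(u)_w ≠ 0`) and every weight `O`,
`Σᶠ_c Δ_v(γ_H, c̃)·O(c) = (−1)^{n(γ_H)} q_v^{−n(γ_H)} · Σᶠ_c [ι_v(γ_H) ↔ c̃]·κ_v(γ_H, c̃)·O(c)`, `n(γ_H) := (−log |χ_g(u)_w|).toNat` — «GEN»'s right-hand side is the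
`κ`-orbital sum up to this scalar. [cite: Rogawski1990, §4.9 p. 55; §4.3 p. 43; Prop. 8.1.3 p. 116] [cite: LabesseLanglands1979, §2] -/
theorem exists_nhds_one_forall_finsum_Δ_mul_eq_toNat :
    ∃ V ∈ 𝓝 (1 : (cmDatum L 2 (Matrix.of fun i j : Fin 2 => if i.val + j.val + 1 = 2 then (1 : L) else 0)).Local v ×
        (cmDatum L 1 (Matrix.of fun i j : Fin 1 => if i.val + j.val + 1 = 1 then (1 : L) else 0)).Local v),
      ∀ γH ∈ V, ∀ O : ConjClasses ((cmDatum L 3 H').Local v) → ℂ, ((finCharpolyTwo L v γH).eval (finGammaTwo L v γH)) w ≠ 0 →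
        ∑ᶠ c : ConjClasses ((cmDatum L 3 H').Local v), (finExplicitCollection L H' μ hl hr v).Δ γH (Quotient.out c) * O c =
          (-1 : ℂ) ^ (-WithZero.log (Valued.v (((finCharpolyTwo L v γH).eval (finGammaTwo L v γH)) w))).toNat *
            (((Nat.card (𝓞 ↥(maximalRealSubfield L) ⧸ v.asIdeal) : ℂ) ^
              (-WithZero.log (Valued.v (((finCharpolyTwo L v γH).eval (finGammaTwo L v γH)) w))).toNat))⁻¹ *
            ∑ᶠ c : ConjClasses ((cmDatum L 3 H').Local v),
              (if IsLocalNormPair L H' v γH (Quotient.out c) then ((finKappaAt L v H' γH (Quotient.out c) : ℤ) : ℂ) else 0) * O c := by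
  obtain ⟨V, hV, h⟩ := exists_nhds_one_forall_finsum_Δ_mul_eq L v w hw hunr μ hμω H' hl hr
  obtain ⟨U, hU, hU1⟩ := (eventually_nhds_one_valued_eval_lt_one L v w).exists_mem
  refine ⟨V ∩ U, Filter.inter_mem hV hU, fun γH hγ O hχ0 => ?_⟩
  exact h γH hγ.1 _ O (valued_eq_pow_toNat_of_ne_zero L v w hunr hχ0 (hU1 γH hγ.2).le)

end ScalarPull

end Literature.NumberTheory.Rogawski1990
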